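import Mathlib
import Summits.Ventures.PercRepro2.MixChordRoot
import Summits.Ventures.PercRepro2.A3Inactive

/-!
# A second induction: (MIX-CHORD) along the edges at the weight-`1` cluster of `a₃` ⟹ the crux
(blind cell PercRepro2, night-1 g19; proofs/NIGHT1-G19.md §6)

`a3Edges p` = the fractional edges touching `S₃`, the weight-`1` cluster of `a₃`; the row
**`MixChordA3 p`** asks the mixed chord along every such edge (census 3,235 / 3,235: 1,701 edges at
`a₃` and 1,534 edges at `S₃ ∖ {a₃}`, NIGHT1-G19.md §6; the edges at `a₃` alone 1,993 / 1,993 in §1).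
The induction is the one of `MixChord.lean` with the other edge set; its BASE is new: with no
fractional edge at `S₃`, either a root lies in `S₃` — then `a₃` is surely joined to it, `PD` is
null and `Gc = 0` — or the cluster of `a₃` stays inside `S₃` on the support (`cluster_subset_of_no_a3Edge`),
`a₃` is inactive ON THE SUPPORT and (HCOV) is mine-2's BHK cross-cluster identity
(`Gc_eq_of_a3Inactive_support`, the support form of `A3Inactive.Gc_eq_of_a3Inactive`).
**`HCov_all_of_mixChordA3_all : MixChordA3_all R → HCov_all R`.**  The edges from `a₃` to a root
are closed by g18's theorem (`mixChord_root_edge`), the edge `{a₃, o}` carries g18's two X-free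
rows, the rest (`{a₃, b}`, hub edges, the edges at `S₃ ∖ {a₃}`) is open.

Own code; standard axioms.
-/

namespace Summit.Ventures.PercRepro2

open UnionCluster CovForm

namespace Mix

open scoped Classical

section A3Defs

variable {V : Type*} {E : Type*} [Fintype E] [DecidableEq E] {R : Type*} [Field R]
  [LinearOrder R]

/-- The fractional edges touching the weight-`1` cluster of `a₃`. -/
noncomputable def a3Edges (p : E → R) (ends : E → Sym2 V) (a₃ : V) : Finset E :=
  (Chord.frac p).filter fun e => e ∈ touches ends (cluster ends (Chord.oneConfig p) a₃)

/-- **(MIX-CHORD) along the edges at `S₃`** at the weight vector `p`. -/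
def MixChordA3 (p : E → R) (ends : E → Sym2 V) (o a₁ a₂ a₃ b : V) : Prop :=
  ∀ e ∈ a3Edges p ends a₃,
    p e * Gc (Function.update p e 1) ends o a₁ a₂ a₃ b +
      (1 - p e) * (shrink p ends a₁ a₂ a₃ e * Gc (Function.update p e 0) ends o a₁ a₂ a₃ b) ≤
        Gc p ends o a₁ a₂ a₃ b

end A3Defs

section A3All

variable (R : Type*) [Field R] [LinearOrder R] [IsStrictOrderedRing R]

/-- Row (MIX-CHORD-A3) over all finite graphs, admissible weights and markings. -/
def MixChordA3_all : Prop :=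
  ∀ (V E : Type) [Fintype V] [DecidableEq V] [Fintype E] [DecidableEq E]
    (ends : E → Sym2 V) (p : E → R), IsProbVec p →
    ∀ o a₁ a₂ a₃ b : V, a₁ ≠ a₂ → a₁ ≠ a₃ → a₂ ≠ a₃ → o ≠ a₁ → o ≠ a₂ → o ≠ a₃ → o ≠ b →
      b ≠ a₁ → b ≠ a₂ → b ≠ a₃ → MixChordA3 p ends o a₁ a₂ a₃ b

end A3All

/-! ## An inactive `a₃` on the support -/

section InactiveSupport

variable {V : Type*} {E : Type*} [Fintype E] [DecidableEq E] [DecidableEq V] {R : Type*}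
  [Field R] [LinearOrder R] [IsStrictOrderedRing R]

variable (p : E → R) (ends : E → Sym2 V) {a₁ a₂ a₃ : V}

omit [DecidableEq V] [LinearOrder R] [IsStrictOrderedRing R] in
/-- `T` is null when `a₃` is inactive on the support. -/
lemma prob_T_inter_eq_zero_support
    (h : ∀ ω, weight p ω ≠ 0 → ¬ Conn ends ω a₁ a₃ ∧ ¬ Conn ends ω a₂ a₃) (X : Set (Config E)) :
    prob p (TEvent ends a₁ a₂ a₃ ∩ X) = 0 := by
  unfold prob
  refine Finset.sum_eq_zero fun ω _ => ?_
  by_cases hω : weight p ω = 0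
  · simp [Set.indicator_apply, hω]
  · rw [Set.indicator_of_notMem]
    rintro ⟨⟨_, h23⟩, _⟩
    exact (h ω hω).2 h23

omit [DecidableEq V] [LinearOrder R] [IsStrictOrderedRing R] in
/-- `T′` is null when `a₃` is inactive on the support. -/
lemma prob_T'_inter_eq_zero_support
    (h : ∀ ω, weight p ω ≠ 0 → ¬ Conn ends ω a₁ a₃ ∧ ¬ Conn ends ω a₂ a₃) (X : Set (Config E)) :
    prob p (TEvent ends a₂ a₁ a₃ ∩ X) = 0 := by
  unfold prob
  refine Finset.sum_eq_zero fun ω _ => ?_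
  by_cases hω : weight p ω = 0
  · simp [Set.indicator_apply, hω]
  · rw [Set.indicator_of_notMem]
    rintro ⟨⟨_, h13⟩, _⟩
    exact (h ω hω).1 h13

omit [DecidableEq V] [LinearOrder R] [IsStrictOrderedRing R] in
/-- `PD = Q` when `a₃` is inactive on the support. -/
lemma prob_PD_inter_eq_Q_support
    (h : ∀ ω, weight p ω ≠ 0 → ¬ Conn ends ω a₁ a₃ ∧ ¬ Conn ends ω a₂ a₃) (X : Set (Config E)) :
    prob p (PDEvent ends a₁ a₂ a₃ ∩ X) = prob p (avoidAll ends a₂ {a₁} ∩ X) := by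
  unfold prob
  refine Finset.sum_congr rfl fun ω _ => ?_
  by_cases hω : weight p ω = 0
  · simp [Set.indicator_apply, hω]
  · have hiff : ω ∈ PDEvent ends a₁ a₂ a₃ ∩ X ↔ ω ∈ avoidAll ends a₂ {a₁} ∩ X := by
      simp only [PDEvent, Dtilde, UnionCluster.inU, Set.mem_inter_iff, Set.mem_compl_iff,
        mem_connEvent, mem_avoidAll, Finset.mem_singleton, forall_eq]
      constructor
      · rintro ⟨⟨h12, _⟩, hX⟩
        exact ⟨fun h21 => h12 (conn_symm h21), hX⟩
      · rintro ⟨h21, hX⟩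
        refine ⟨⟨fun h12 => h21 (conn_symm h12), ?_⟩, hX⟩
        rintro (h31 | h32)
        · exact (h ω hω).1 (conn_symm h31)
        · exact (h ω hω).2 (conn_symm h32)
    by_cases hm : ω ∈ PDEvent ends a₁ a₂ a₃ ∩ X
    · rw [Set.indicator_of_mem hm, Set.indicator_of_mem (hiff.1 hm)]
    · rw [Set.indicator_of_notMem hm, Set.indicator_of_notMem (fun h' => hm (hiff.2 h'))]

omit [DecidableEq V] in
/-- **`Gc` with `a₃` inactive on the support** is mine-2's identity
`Gc = 2 P(Q) · (S(bL, oH) + S(bH, oL))`. -/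
theorem Gc_eq_of_a3Inactive_support (o b : V)
    (h : ∀ ω, weight p ω ≠ 0 → ¬ Conn ends ω a₁ a₃ ∧ ¬ Conn ends ω a₂ a₃) :
    Gc p ends o a₁ a₂ a₃ b =
      2 * prob p (avoidAll ends a₂ {a₁}) *
        ((prob p (avoidAll ends a₂ {a₁} ∩ connEvent ends a₁ b) *
            prob p (avoidAll ends a₂ {a₁} ∩ connEvent ends a₂ o) -
          prob p (avoidAll ends a₂ {a₁}) *
            prob p (avoidAll ends a₂ {a₁} ∩ (connEvent ends a₂ o ∩ connEvent ends a₁ b))) +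
         (prob p (avoidAll ends a₂ {a₁} ∩ connEvent ends a₂ b) *
            prob p (avoidAll ends a₂ {a₁} ∩ connEvent ends a₁ o) -
          prob p (avoidAll ends a₂ {a₁}) *
            prob p (avoidAll ends a₂ {a₁} ∩ (connEvent ends a₁ o ∩ connEvent ends a₂ b)))) := by
  have hT := prob_T_inter_eq_zero_support p ends h
  have hT' := prob_T'_inter_eq_zero_support p ends h
  have hPD := prob_PD_inter_eq_Q_support p ends h
  have hT0 : prob p (TEvent ends a₁ a₂ a₃) = 0 := by simpa using hT Set.univ
  have hT'0 : prob p (TEvent ends a₂ a₁ a₃) = 0 := by simpa using hT' Set.univ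
  have hPD0 : prob p (PDEvent ends a₁ a₂ a₃) = prob p (avoidAll ends a₂ {a₁}) := by
    simpa using hPD Set.univ
  unfold Gc DEF EQbo EQb3 EQb3o EQo EQ3 EQ3o PDb PDbo Do
  rw [gap_eq_Q]
  simp only [hT, hT', hPD, hT0, hT'0, hPD0]
  ring

/-- **(HCOV) when `a₃` is inactive on the support** (mine-2's `HCov_of_a3Inactive`, support form). -/
theorem HCov_of_a3Inactive_support [Fintype V] (hp : IsProbVec p) (o b : V)
    (h : ∀ ω, weight p ω ≠ 0 → ¬ Conn ends ω a₁ a₃ ∧ ¬ Conn ends ω a₂ a₃) :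
    HCov p ends o a₁ a₂ a₃ b := by
  unfold HCov
  rw [Gc_eq_of_a3Inactive_support p ends o b h]
  have hQ := prob_nonneg hp (avoidAll ends a₂ {a₁})
  have h1 := A3Inactive.bLoH_mul_Q_le p hp ends o a₁ a₂ b
  have h2 := A3Inactive.bHoL_mul_Q_le p hp ends o a₁ a₂ b
  have hS : 0 ≤ (prob p (avoidAll ends a₂ {a₁} ∩ connEvent ends a₁ b) *
            prob p (avoidAll ends a₂ {a₁} ∩ connEvent ends a₂ o) -
          prob p (avoidAll ends a₂ {a₁}) *
            prob p (avoidAll ends a₂ {a₁} ∩ (connEvent ends a₂ o ∩ connEvent ends a₁ b))) +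
         (prob p (avoidAll ends a₂ {a₁} ∩ connEvent ends a₂ b) *
            prob p (avoidAll ends a₂ {a₁} ∩ connEvent ends a₁ o) -
          prob p (avoidAll ends a₂ {a₁}) *
            prob p (avoidAll ends a₂ {a₁} ∩ (connEvent ends a₁ o ∩ connEvent ends a₂ b))) := by
    linarith
  exact mul_nonneg (mul_nonneg (by norm_num) hQ) hS

end InactiveSupport

/-! ## The base: no fractional edge at `S₃` -/

section Base

variable {V : Type*} {E : Type*} [Fintype E] [DecidableEq E] [DecidableEq V] {R : Type*}
  [Field R] [LinearOrder R] [IsStrictOrderedRing R]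

variable {p : E → R} {ends : E → Sym2 V} {a₁ a₂ a₃ : V}

omit [DecidableEq E] [DecidableEq V] in
/-- With no fractional edge at `S₃`, the cluster of `a₃` on the support stays inside `S₃`. -/
lemma cluster_subset_of_no_a3Edge (h0 : a3Edges p ends a₃ = ∅) {ω : Config E}
    (hω : weight p ω ≠ 0) {v : V} (hv : Conn ends ω a₃ v) :
    v ∈ cluster ends (Chord.oneConfig p) a₃ := by
  refine mem_of_conn_of_closed (ends := ends) (ω := ω)
    (S := cluster ends (Chord.oneConfig p) a₃) ?_ (mem_cluster_self ends _ a₃) hv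
  intro x hx y hxy
  obtain ⟨_, e, he, hends⟩ := openGraph_adj.1 hxy
  -- `e` touches `S₃` and is not fractional, hence of weight `1` (it is open on the support)
  have htouch : e ∈ touches ends (cluster ends (Chord.oneConfig p) a₃) := ⟨x, hx, y, hends⟩
  have hnf : e ∉ Chord.frac p := by
    intro hf
    have : e ∈ a3Edges p ends a₃ := Finset.mem_filter.2 ⟨hf, htouch⟩
    rw [h0] at this
    exact Finset.notMem_empty e this
  have hone : Chord.oneConfig p e = true := by
    rw [← Chord.support_eq_oneConfig hω hnf]; exact he
  exact mem_cluster.2 (conn_trans (mem_cluster.1 hx) (conn_of_openAdj ⟨e, hone, hends⟩))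

omit [DecidableEq E] [DecidableEq V] in
/-- With no fractional edge at `S₃` and no root in `S₃`, `a₃` is inactive on the support. -/
lemma inactive_support_of_no_a3Edge (h0 : a3Edges p ends a₃ = ∅)
    (h1 : a₁ ∉ cluster ends (Chord.oneConfig p) a₃) (h2 : a₂ ∉ cluster ends (Chord.oneConfig p) a₃) :
    ∀ ω, weight p ω ≠ 0 → ¬ Conn ends ω a₁ a₃ ∧ ¬ Conn ends ω a₂ a₃ := fun _ hω =>
  ⟨fun h => h1 (cluster_subset_of_no_a3Edge h0 hω (conn_symm h)),
    fun h => h2 (cluster_subset_of_no_a3Edge h0 hω (conn_symm h))⟩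

omit [DecidableEq V] [LinearOrder R] [IsStrictOrderedRing R] in
/-- `PD` is null when `a₃` is surely joined to a root on the support. -/
lemma prob_PD_eq_zero_of_sure_root {r : V} (hr : r = a₁ ∨ r = a₂)
    (h : ∀ ω, weight p ω ≠ 0 → Conn ends ω a₃ r) : prob p (PDEvent ends a₁ a₂ a₃) = 0 := by
  unfold prob
  refine Finset.sum_eq_zero fun ω _ => ?_
  by_cases hω : weight p ω = 0
  · simp [Set.indicator_apply, hω]
  · rw [Set.indicator_of_notMem]
    rintro ⟨_, hD⟩
    apply hD
    rcases hr with rfl | rfl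
    · exact Or.inl (h ω hω)
    · exact Or.inr (h ω hω)

/-- **The base**: with no fractional edge at `S₃`, `Gc ≥ 0`. -/
theorem Gc_nonneg_of_no_a3Edge [Fintype V] (hp : IsProbVec p) (h0 : a3Edges p ends a₃ = ∅)
    (o b : V) : 0 ≤ Gc p ends o a₁ a₂ a₃ b := by
  by_cases h1 : a₁ ∈ cluster ends (Chord.oneConfig p) a₃
  · have hD : prob p (PDEvent ends a₁ a₂ a₃) = 0 :=
      prob_PD_eq_zero_of_sure_root (Or.inl rfl) fun ω hω => conn_of_mem_oneCluster hω h1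
    rw [Chord.Gc_eq_zero_of_degenerate hp ends o a₁ a₂ a₃ b (by rw [hD, zero_mul])]
  by_cases h2 : a₂ ∈ cluster ends (Chord.oneConfig p) a₃
  · have hD : prob p (PDEvent ends a₁ a₂ a₃) = 0 :=
      prob_PD_eq_zero_of_sure_root (Or.inr rfl) fun ω hω => conn_of_mem_oneCluster hω h2
    rw [Chord.Gc_eq_zero_of_degenerate hp ends o a₁ a₂ a₃ b (by rw [hD, zero_mul])]
  exact HCov_of_a3Inactive_support p ends hp o b (inactive_support_of_no_a3Edge h0 h1 h2)

end Base

/-! ## The induction -/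

section Induction

variable {V : Type*} {E : Type*} [Fintype E] [DecidableEq E] [Fintype V] [DecidableEq V]
  {R : Type*} [Field R] [LinearOrder R] [IsStrictOrderedRing R]

/-- **(MIX-CHORD-A3) ⟹ `Gc ≥ 0`**: strong induction on the number of fractional edges, the base
`Gc_nonneg_of_no_a3Edge`. -/
theorem Gc_nonneg_of_mixChordA3 (ends : E → Sym2 V) (o a₁ a₂ a₃ b : V)
    (hmix : ∀ q : E → R, IsProbVec q → MixChordA3 q ends o a₁ a₂ a₃ b) :
    ∀ (n : ℕ) (p : E → R), IsProbVec p → (Chord.frac p).card = n →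
      0 ≤ Gc p ends o a₁ a₂ a₃ b := by
  intro n
  induction n using Nat.strong_induction_on with
  | _ n ih =>
  intro p hp hn
  by_cases h0 : a3Edges p ends a₃ = ∅
  · exact Gc_nonneg_of_no_a3Edge hp h0 o b
  · obtain ⟨e, he⟩ := Finset.nonempty_iff_ne_empty.2 h0
    have hf : e ∈ Chord.frac p := by
      simp only [a3Edges, Finset.mem_filter] at he
      exact he.1
    have hlt : ((Chord.frac p).erase e).card < n := by
      rw [← hn]
      exact Finset.card_erase_lt_of_mem hf
    have h1 := ih _ hlt _ (hp.update e zero_le_one le_rfl) (by rw [Chord.frac_update_one hf])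
    have h2 := ih _ hlt _ (hp.update e le_rfl zero_le_one) (by rw [Chord.frac_update_zero hf])
    have hle := hmix p hp e he
    exact (add_nonneg (mul_nonneg (hp.nonneg e) h1)
      (mul_nonneg (sub_nonneg.2 (hp.le_one e)) (mul_nonneg (shrink_nonneg hp ends a₁ a₂ a₃ e) h2))).trans hle

/-- **(MIX-CHORD-A3) ⟹ (HCOV)** at every admissible weight vector of the instance. -/
theorem HCov_of_mixChordA3 (ends : E → Sym2 V) (o a₁ a₂ a₃ b : V)
    (hmix : ∀ q : E → R, IsProbVec q → MixChordA3 q ends o a₁ a₂ a₃ b) (p : E → R)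
    (hp : IsProbVec p) : HCov p ends o a₁ a₂ a₃ b :=
  Gc_nonneg_of_mixChordA3 ends o a₁ a₂ a₃ b hmix _ p hp rfl

end Induction

section ChainAll

variable (R : Type*) [Field R] [LinearOrder R] [IsStrictOrderedRing R]

/-- **(MIX-CHORD-A3) on all instances ⟹ the crux `CovForm.HCov_all`.** -/
theorem HCov_all_of_mixChordA3_all (h : MixChordA3_all R) : HCov_all R := by
  intro V E _ _ _ _ ends p hp o a₁ a₂ a₃ b h12 h13 h23 ho1 ho2 ho3 hob hb1 hb2 hb3
  exact HCov_of_mixChordA3 ends o a₁ a₂ a₃ b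
    (fun q hq => h V E ends q hq o a₁ a₂ a₃ b h12 h13 h23 ho1 ho2 ho3 hob hb1 hb2 hb3) p hp

end ChainAll

end Mix

end Summit.Ventures.PercRepro2
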